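import Mathlib
import Summits.CriticalPhenomena.PercolationContinuityZ3.Theorems.PercNearOneGluingNoHeavyLowerTailOrientedAntipodalHallAcyclic

/-!
# Any number of petals: a labelling has at most twice as many antipodal bads as goods

Helper file for crux `stmt-CriticalPhenomena-4575` (`NoHeavyLowerTail`, route `PercNearOneGluingNoHeavy`), hull-port seat `prim-hp-7`
(generation 59); `--supports stmt-CriticalPhenomena-4575`.  Everything here is PROVED; no definitions, no `sorry`.

Setting of `…OrientedAntipodalHall*`: a monotone labelling `f : Finset α → Lab k`, a ground set `S`; an antipodal bad of `S` is an `X ⊆ S` with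
`f X = petal a`, `f (S \ X) = petal b`, `a ≠ b`; a good is a `U ⊆ S` with `f U = top`, `f (S \ U) = bot`.

**Theorem (`card_bads_le_two_mul_card_goods`).**  `#{antipodal bads of S} ≤ 2 · #{goods of S}`; equivalently the number of complementary PAIRS `{X, S \ X}` of bads is
at most the number of goods (`card_descendingBads_le_card_goods`: the bads whose tail petal has larger index than the head petal — one from each complementary pair —
are at most as many as the goods lying above them).  Proof: the descending bads form a family with an ACYCLIC type digraph, so prim-ineq-gen-3's
`card_le_card_goods_above_acyclic` (height = petal index) applies; complementation is a bijection between descending and ascending bads.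

This is the proved special case `g = h` of hp-7's Conjecture FS (memo `prim-hp-7/FROM-prim-hp-7-g59-T6-EXACT.md` §3): for every point `e`,
`#{goods ∋ e} ≥ #{complement pairs at e containing a bad}` (exhaustively verified for all three-petal labellings of `2^5`; open).  (prim-hp-7 gen 59, 2026-08-23.)
-/

namespace Summit.CriticalPhenomena.PercolationContinuityZ3.Theorems

namespace OrientedAntipodalHall

open Finset AntipodalStrongHarris AntipodalStrongHarris.Lab

variable {α : Type*} [DecidableEq α] {k : ℕ}

/-- **Descending bads are at most as many as the goods above them.**  For a monotone labelling `f` and a ground set `S`, the antipodal bads `X ⊆ S`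
of type `(a, b)` with `b < a` number at most the goods `U ⊆ S` (`f U = top`, `f (S \ U) = bot`) containing one of them. -/
theorem card_descendingBads_le_card_goods (S : Finset α) {f : Finset α → Lab k}
    (hf : ∀ ⦃X Y : Finset α⦄, X ⊆ Y → f X ≤ f Y) :
    #{X ∈ S.powerset | ∃ a b : Fin k, b < a ∧ f X = petal a ∧ f (S \ X) = petal b} ≤
      #{U ∈ S.powerset | f U = top ∧ f (S \ U) = bot ∧
        ∃ X ∈ {X ∈ S.powerset | ∃ a b : Fin k, b < a ∧ f X = petal a ∧ f (S \ X) = petal b}, X ⊆ U} := by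
  classical
  set D : Finset (Finset α) := {X ∈ S.powerset | ∃ a b : Fin k, b < a ∧ f X = petal a ∧ f (S \ X) = petal b} with hD
  by_cases hDe : D = ∅
  · rw [hDe]; simp
  obtain ⟨X₀, hX₀⟩ := nonempty_iff_ne_empty.mpr hDe
  have hX₀' := hX₀
  rw [hD, mem_filter] at hX₀'
  obtain ⟨-, a₀, -, -, -, -⟩ := hX₀'
  -- type maps
  let i : Finset α → Fin k := fun X => if h : ∃ a : Fin k, f X = petal a then h.choose else a₀
  let j : Finset α → Fin k := fun X => if h : ∃ b : Fin k, f (S \ X) = petal b then h.choose else a₀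
  have hmem : ∀ X ∈ D, X ⊆ S ∧ ∃ a b : Fin k, b < a ∧ f X = petal a ∧ f (S \ X) = petal b := by
    intro X hX
    rw [hD, mem_filter, mem_powerset] at hX
    exact hX
  have hi : ∀ X ∈ D, f X = petal (i X) := by
    intro X hX
    obtain ⟨-, a, b, -, ha, -⟩ := hmem X hX
    have h : ∃ a : Fin k, f X = petal a := ⟨a, ha⟩
    simp only [i, dif_pos h]
    exact h.choose_spec
  have hj : ∀ X ∈ D, f (S \ X) = petal (j X) := by
    intro X hX
    obtain ⟨-, a, b, -, -, hb⟩ := hmem X hX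
    have h : ∃ b : Fin k, f (S \ X) = petal b := ⟨b, hb⟩
    simp only [j, dif_pos h]
    exact h.choose_spec
  have hacyc : ∀ X ∈ D, (fun c : Fin k => (c : ℕ)) (j X) < (fun c : Fin k => (c : ℕ)) (i X) := by
    intro X hX
    obtain ⟨-, a, b, hba, ha, hb⟩ := hmem X hX
    have h1 : petal (i X) = (petal a : Lab k) := (hi X hX).symm.trans ha
    have h2 : petal (j X) = (petal b : Lab k) := (hj X hX).symm.trans hb
    have e1 : i X = a := by injection h1
    have e2 : j X = b := by injection h2
    simp only [e1, e2]
    exact hba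
  exact card_le_card_goods_above_acyclic S hf D i j (fun c => (c : ℕ)) (fun X hX => (hmem X hX).1) hi hj hacyc

/-- **At most twice as many antipodal bads as goods** (any number of petals).  Equivalently: the complementary pairs `{X, S \ X}` of bads are at most as
many as the goods of `S`. -/
theorem card_bads_le_two_mul_card_goods (S : Finset α) {f : Finset α → Lab k}
    (hf : ∀ ⦃X Y : Finset α⦄, X ⊆ Y → f X ≤ f Y) :
    #{X ∈ S.powerset | ∃ a b : Fin k, a ≠ b ∧ f X = petal a ∧ f (S \ X) = petal b} ≤
      2 * #{U ∈ S.powerset | f U = top ∧ f (S \ U) = bot} := by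
  classical
  set Dn : Finset (Finset α) := {X ∈ S.powerset | ∃ a b : Fin k, b < a ∧ f X = petal a ∧ f (S \ X) = petal b} with hDn
  set Up : Finset (Finset α) := {X ∈ S.powerset | ∃ a b : Fin k, a < b ∧ f X = petal a ∧ f (S \ X) = petal b} with hUp
  set G : Finset (Finset α) := {U ∈ S.powerset | f U = top ∧ f (S \ U) = bot} with hG
  -- all bads = descending ∪ ascending
  have hsplit : {X ∈ S.powerset | ∃ a b : Fin k, a ≠ b ∧ f X = petal a ∧ f (S \ X) = petal b} ⊆ Dn ∪ Up := by
    intro X hX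
    rw [mem_filter] at hX
    obtain ⟨hXS, a, b, hab, ha, hb⟩ := hX
    rw [mem_union, hDn, hUp, mem_filter, mem_filter]
    rcases lt_or_gt_of_ne hab with h | h
    · exact Or.inr ⟨hXS, a, b, h, ha, hb⟩
    · exact Or.inl ⟨hXS, a, b, h, ha, hb⟩
  -- descending ≤ goods
  have h1 : #Dn ≤ #G := by
    refine (card_descendingBads_le_card_goods S hf).trans (card_le_card ?_)
    intro U hU
    rw [mem_filter] at hU
    rw [hG, mem_filter]
    exact ⟨hU.1, hU.2.1, hU.2.2.1⟩
  -- complementation maps ascending bads injectively into descending bads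
  have h2 : #Up ≤ #Dn := by
    refine card_le_card_of_injOn (fun X => S \ X) (fun X hX => ?_) (fun X hX Y hY hXY => ?_)
    · rw [mem_coe, hUp, mem_filter, mem_powerset] at hX
      obtain ⟨hXS, a, b, hab, ha, hb⟩ := hX
      rw [mem_coe, hDn, mem_filter, mem_powerset]
      refine ⟨sdiff_subset, b, a, hab, hb, ?_⟩
      rwa [Finset.sdiff_sdiff_eq_self hXS]
    · rw [mem_coe, hUp, mem_filter, mem_powerset] at hX hY
      have := congrArg (fun Z => S \ Z) hXY
      simpa only [Finset.sdiff_sdiff_eq_self hX.1, Finset.sdiff_sdiff_eq_self hY.1] using this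
  calc #{X ∈ S.powerset | ∃ a b : Fin k, a ≠ b ∧ f X = petal a ∧ f (S \ X) = petal b}
      ≤ #(Dn ∪ Up) := card_le_card hsplit
    _ ≤ #Dn + #Up := card_union_le _ _
    _ ≤ #G + #G := Nat.add_le_add h1 (h2.trans h1)
    _ = 2 * #G := by ring

end OrientedAntipodalHall

end Summit.CriticalPhenomena.PercolationContinuityZ3.Theorems
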